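import Mathlib.NumberTheory.LSeries.Deriv
import Mathlib.NumberTheory.LSeries.Injectivity
import Mathlib.Analysis.SpecialFunctions.Trigonometric.Bounds
import Mathlib.Analysis.SpecialFunctions.Complex.Log
import HarnessLib

/-!
# Dirichlet polynomials as `L`-series with finitely supported coefficients; prime phases

Topic `Literature/NumberTheory/LFunctions` (namespace `Literature.NumberTheory.LFunctions`).
Everything here is PROVED; the file supports the formalisation of Saias–Weingartner 2009,
Theorem 2 (`SaiasWeingartner.lean`), where "Dirichlet polynomials" `P(s) = ∑ₖ cₖ k^{-s}` are
rendered as `LSeries c` for a finitely supported `c : ℕ → ℂ`.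

* `FiniteLSeries.summable`, `.eq_sum`, `.abscissaOfAbsConv_lt`, `.differentiable`,
  `.analyticAt`: an `L`-series with finitely supported coefficients converges everywhere, is a
  finite sum, and is entire;
* `FiniteLSeries.ne_zero`: it is not the zero function as soon as some coefficient `cₖ`, `k ≥ 1`,
  is non-zero (Mathlib's injectivity of `LSeries`);
* `FiniteLSeries.norm_le`: `|P(s)| ≤ ∑ |cₖ|` for `Re s ≥ 0`;
* `FiniteLSeries.norm_shift_sub_le`: `|P(s + it) − P(s)| ≤ ∑_{k ≥ 1} |cₖ| |k^{-it} − 1|`, `Re s ≥ 0`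
  (the step "`|P_j(s + iτ) − P_j(s)| ≤ …`" of [Pankowski2010], proof of Cor. 5.3);
* prime phases: `norm_natCast_cpow_mul_I_sub_one_le` — if `|p^{iu} − 1| ≤ η` for the primes
  `p ≤ Q` then `|n^{iu} − 1| ≤ nη` for `1 ≤ n ≤ Q` (complete multiplicativity), and
  `norm_natCast_cpow_neg_mul_I_sub_one_le_two_pi` — `|p^{-iτ} − 1| ≤ 2π |τ · (−log p / 2π) − m|` for
  every integer `m` (so that the Diophantine condition `‖τ αₚ‖ < ε` of the hybrid universality
  theorem, `αₚ = −log p / 2π`, controls the phases `p^{-iτ}`).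

## References

* [Pankowski2010] Ł. Pańkowski, Acta Arith. 141 (2010), 59–72, proof of Cor. 5.3 (p. 71).
* [SaiasWeingartner2009] E. Saias, A. Weingartner, Acta Arith. 140 (2009), 335–344, §4.
-/

noncomputable section

open Complex LSeries Finset

namespace Literature.NumberTheory.LFunctions

/-! ### `L`-series with finitely supported coefficients -/

namespace FiniteLSeries

variable {P : ℕ → ℂ}

/-- Outside the support the terms vanish. [folklore] -/
theorem term_eq_zero_of_notMem (hP : (Function.support P).Finite) {n : ℕ}
    (hn : n ∉ hP.toFinset) (s : ℂ) : term P s n = 0 := by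
  have h : P n = 0 := by simpa using hn
  rcases eq_or_ne n 0 with rfl | hn0
  · exact term_zero _ _
  · rw [term_of_ne_zero hn0, h, zero_div]

/-- A Dirichlet polynomial converges everywhere. [folklore] -/
theorem summable (hP : (Function.support P).Finite) (s : ℂ) : LSeriesSummable P s :=
  summable_of_ne_finset_zero fun _ hn ↦ term_eq_zero_of_notMem hP hn s

/-- A Dirichlet polynomial is the finite sum of its terms. [folklore] -/
theorem eq_sum (hP : (Function.support P).Finite) (s : ℂ) :
    LSeries P s = ∑ n ∈ hP.toFinset, term P s n :=
  tsum_eq_sum fun _ hn ↦ term_eq_zero_of_notMem hP hn s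

/-- The abscissa of absolute convergence of a Dirichlet polynomial lies to the left of every
point. [folklore] -/
theorem abscissaOfAbsConv_lt (hP : (Function.support P).Finite) (s : ℂ) :
    abscissaOfAbsConv P < s.re := by
  have h : abscissaOfAbsConv P ≤ (s.re - 1 : ℝ) :=
    abscissaOfAbsConv_le_of_forall_lt_LSeriesSummable fun y _ ↦ summable hP y
  exact h.trans_lt (by exact_mod_cast sub_one_lt s.re)

/-- A Dirichlet polynomial is analytic at every point. [folklore] -/
theorem analyticAt (hP : (Function.support P).Finite) (s : ℂ) : AnalyticAt ℂ (LSeries P) s :=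
  LSeries_analyticOnNhd P s (abscissaOfAbsConv_lt hP s)

/-- A Dirichlet polynomial is an entire function. [folklore] -/
theorem differentiable (hP : (Function.support P).Finite) : Differentiable ℂ (LSeries P) :=
  fun s ↦ (analyticAt hP s).differentiableAt

/-- A Dirichlet polynomial is continuous. [folklore] -/
theorem continuous (hP : (Function.support P).Finite) : Continuous (LSeries P) :=
  (differentiable hP).continuous

/-- **A non-zero Dirichlet polynomial is not the zero function**: if some coefficient `P k`,
`k ≥ 1`, is non-zero then `LSeries P ≠ 0` (injectivity of `L`-series). [folklore] -/
theorem ne_zero (hP : (Function.support P).Finite) (h0 : ∃ n, n ≠ 0 ∧ P n ≠ 0) :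
    LSeries P ≠ 0 := by
  classical
  obtain ⟨k, hk, hPk⟩ := h0
  -- replace `P` by the function vanishing at `0`
  set F : ℕ → ℂ := fun n ↦ if n = 0 then 0 else P n with hF
  have hFP : ∀ {n : ℕ}, n ≠ 0 → F n = P n := fun hn ↦ if_neg hn
  have hLF : LSeries F = LSeries P := funext fun s ↦ LSeries_congr (fun hn ↦ hFP hn) s
  have hFsupp : (Function.support F).Finite := by
    refine hP.subset fun n hn ↦ ?_
    rcases eq_or_ne n 0 with rfl | hn0
    · simp [hF] at hn
    · simpa [Function.mem_support, hFP hn0] using hn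
  have habs : abscissaOfAbsConv F ≠ ⊤ :=
    ((abscissaOfAbsConv_lt hFsupp 0).trans_le le_top).ne
  intro hzero
  rw [← hLF, LSeries_eq_zero_iff (by simp [hF])] at hzero
  rcases hzero with h | h
  · exact hPk (by simpa [hF, hk] using congrFun h k)
  · exact habs h

/-- `|k^{-s}|`-free bound: for `Re s ≥ 0`, `|term P s n| ≤ |P n|`. [folklore] -/
theorem norm_term_le {s : ℂ} (hs : 0 ≤ s.re) (n : ℕ) : ‖term P s n‖ ≤ ‖P n‖ := by
  rcases eq_or_ne n 0 with rfl | hn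
  · simp
  · rw [norm_term_eq, if_neg hn]
    refine div_le_self (norm_nonneg _) ?_
    exact Real.one_le_rpow (by exact_mod_cast Nat.one_le_iff_ne_zero.2 hn) hs

/-- For `Re s ≥ 0`, `|P(s)| ≤ ∑ₖ |P k|`. [folklore] -/
theorem norm_le (hP : (Function.support P).Finite) {s : ℂ} (hs : 0 ≤ s.re) :
    ‖LSeries P s‖ ≤ ∑ n ∈ hP.toFinset, ‖P n‖ := by
  rw [eq_sum hP]
  exact (norm_sum_le _ _).trans (sum_le_sum fun n _ ↦ norm_term_le hs n)

/-- `‖n^{iu}‖ = 1` for `n ≥ 1` and real `u` (a private copy of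
`Literature.Barriers.RiemannHypothesis.norm_natCast_cpow_mul_I`, to keep the imports light).
[folklore] -/
private theorem norm_natCast_cpow_mul_I {n : ℕ} (hn : n ≠ 0) (u : ℝ) :
    ‖(n : ℂ) ^ ((u : ℂ) * I)‖ = 1 := by
  rw [norm_natCast_cpow_of_pos (Nat.pos_of_ne_zero hn)]
  simp

/-- Termwise shift: for `Re s ≥ 0`, `|term(s + it) − term(s)| ≤ |P n| · |n^{-it} − 1|`.
[folklore] -/
theorem norm_term_shift_sub_le {s : ℂ} (hs : 0 ≤ s.re) (t : ℝ) (n : ℕ) :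
    ‖term P (s + t * I) n - term P s n‖ ≤ ‖P n‖ * ‖(n : ℂ) ^ (((-t : ℝ) : ℂ) * I) - 1‖ := by
  rcases eq_or_ne n 0 with rfl | hn
  · simp only [term_zero, sub_self, norm_zero]
    positivity
  have hn' : (n : ℂ) ≠ 0 := Nat.cast_ne_zero.2 hn
  have hsplit : term P (s + t * I) n - term P s n =
      P n * (n : ℂ) ^ (-s) * ((n : ℂ) ^ (((-t : ℝ) : ℂ) * I) - 1) := by
    rw [term_of_ne_zero hn, term_of_ne_zero hn, div_eq_mul_inv, div_eq_mul_inv,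
      ← cpow_neg, ← cpow_neg, neg_add, cpow_add _ _ hn']
    push_cast
    ring
  rw [hsplit, norm_mul, norm_mul]
  have h1 : ‖(n : ℂ) ^ (-s)‖ ≤ 1 := by
    rw [norm_natCast_cpow_of_pos (Nat.pos_of_ne_zero hn), neg_re]
    exact Real.rpow_le_one_of_one_le_of_nonpos (by exact_mod_cast Nat.one_le_iff_ne_zero.2 hn)
      (by linarith)
  calc ‖P n‖ * ‖(n : ℂ) ^ (-s)‖ * ‖(n : ℂ) ^ (((-t : ℝ) : ℂ) * I) - 1‖
      ≤ ‖P n‖ * 1 * ‖(n : ℂ) ^ (((-t : ℝ) : ℂ) * I) - 1‖ := by gcongr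
    _ = ‖P n‖ * ‖(n : ℂ) ^ (((-t : ℝ) : ℂ) * I) - 1‖ := by rw [mul_one]

/-- **Shift of a Dirichlet polynomial**: for `Re s ≥ 0` and real `t`,
`|P(s + it) − P(s)| ≤ ∑_{k ≥ 1} |P k| · |k^{-it} − 1|` ([Pankowski2010], proof of Cor. 5.3:
"`|P_j(s + iτ) − P_j(s)| ≤ max ∑ |aᵢ| e^{-λᵢσ} |e^{-iτλᵢ} − 1|`").
[cite: Pankowski2010, Cor. 5.3 (proof)] -/
theorem norm_shift_sub_le (hP : (Function.support P).Finite) {s : ℂ} (hs : 0 ≤ s.re) (t : ℝ) :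
    ‖LSeries P (s + t * I) - LSeries P s‖ ≤
      ∑ n ∈ hP.toFinset with n ≠ 0, ‖P n‖ * ‖(n : ℂ) ^ (((-t : ℝ) : ℂ) * I) - 1‖ := by
  rw [eq_sum hP, eq_sum hP, ← sum_sub_distrib]
  have h0 : ∀ n ∈ hP.toFinset, term P (s + t * I) n - term P s n ≠ 0 → n ≠ 0 := by
    rintro n - h rfl
    exact h (by simp)
  rw [← sum_filter_of_ne h0]
  exact (norm_sum_le _ _).trans (sum_le_sum fun n _ ↦ norm_term_shift_sub_le hs t n)

end FiniteLSeries

/-! ### Prime phases -/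

/-- **Complete multiplicativity of the phase error**: if `|p^{iu} − 1| ≤ η` for all primes
`p ≤ Q`, then `|n^{iu} − 1| ≤ nη` for all `1 ≤ n ≤ Q`. [folklore] -/
theorem norm_natCast_cpow_mul_I_sub_one_le {u η : ℝ} (hη : 0 ≤ η) {Q : ℕ}
    (h : ∀ p : ℕ, p.Prime → p ≤ Q → ‖(p : ℂ) ^ ((u : ℂ) * I) - 1‖ ≤ η) :
    ∀ n : ℕ, n ≠ 0 → n ≤ Q → ‖(n : ℂ) ^ ((u : ℂ) * I) - 1‖ ≤ n * η := by
  intro n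
  induction n using Nat.strong_induction_on with
  | _ n ih =>
    intro hn hnQ
    rcases Nat.lt_or_ge n 2 with hlt | hge
    · obtain rfl : n = 1 := by omega
      simpa using hη
    set p := n.minFac with hp
    have hpp : p.Prime := Nat.minFac_prime (by omega)
    obtain ⟨m, hm⟩ := (Nat.minFac_dvd n : p ∣ n)
    have hm0 : m ≠ 0 := by rintro rfl; simp at hm; exact hn hm
    have hp2 : 2 ≤ p := hpp.two_le
    have hmn : m < n := by
      rcases Nat.eq_or_lt_of_le (Nat.one_le_iff_ne_zero.2 hm0) with h1 | h1
      · rw [hm, ← h1]; omega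
      · calc m < 2 * m := by omega
          _ ≤ p * m := Nat.mul_le_mul_right m hp2
          _ = n := hm.symm
    have hpQ : p ≤ Q := (Nat.minFac_le (by omega)).trans hnQ
    have ihm := ih m hmn hm0 (hmn.le.trans hnQ)
    have hψ := h p hpp hpQ
    have hsplit : (n : ℂ) ^ ((u : ℂ) * I) - 1 =
        ((p : ℂ) ^ ((u : ℂ) * I) - 1) * (m : ℂ) ^ ((u : ℂ) * I) +
          ((m : ℂ) ^ ((u : ℂ) * I) - 1) := by
      rw [hm, Nat.cast_mul, natCast_mul_natCast_cpow]
      ring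
    rw [hsplit]
    refine (norm_add_le _ _).trans ?_
    rw [norm_mul, FiniteLSeries.norm_natCast_cpow_mul_I hm0, mul_one]
    have hcast : ((p * m : ℕ) : ℝ) = p * m := by push_cast; ring
    rw [hm, hcast]
    have hpm : (1 : ℝ) + m ≤ p * m := by
      have h1 : 1 + m ≤ p * m :=
        calc 1 + m ≤ m + m := by omega
          _ = 2 * m := by ring
          _ ≤ p * m := Nat.mul_le_mul_right m hp2
      exact_mod_cast h1
    calc ‖(p : ℂ) ^ ((u : ℂ) * I) - 1‖ + ‖(m : ℂ) ^ ((u : ℂ) * I) - 1‖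
        ≤ η + m * η := add_le_add hψ ihm
      _ = (1 + m) * η := by ring
      _ ≤ p * m * η := mul_le_mul_of_nonneg_right hpm hη

/-- **Phases from the Diophantine condition**: for a prime (indeed any `p ≥ 1`), real `τ` and an
integer `m`, `|p^{-iτ} − 1| ≤ 2π |τ · (−log p / 2π) − m|` (`p^{-iτ} = e(τ αₚ)` with
`αₚ = −log p / 2π`, and `|e^{ix} − 1| ≤ |x|`). [folklore] -/
theorem norm_natCast_cpow_neg_mul_I_sub_one_le_two_pi {p : ℕ} (hp : p ≠ 0) (τ : ℝ) (m : ℤ) :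
    ‖(p : ℂ) ^ (((-τ : ℝ) : ℂ) * I) - 1‖ ≤
      2 * Real.pi * |τ * (-Real.log p / (2 * Real.pi)) - m| := by
  have hp' : (p : ℂ) ≠ 0 := Nat.cast_ne_zero.2 hp
  set x : ℝ := -τ * Real.log p - 2 * Real.pi * m with hx
  have hcpow : (p : ℂ) ^ (((-τ : ℝ) : ℂ) * I) = Complex.exp (I * (x : ℂ)) := by
    rw [cpow_def_of_ne_zero hp', ← natCast_log, hx]
    have h2 : Complex.exp (I * ((-τ * Real.log p - 2 * Real.pi * m : ℝ) : ℂ)) =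
        Complex.exp ((Real.log p : ℂ) * ((-τ : ℝ) : ℂ) * I) *
          Complex.exp ((-m : ℤ) * (2 * Real.pi * I)) := by
      rw [← Complex.exp_add]
      congr 1
      push_cast
      ring
    rw [h2, exp_int_mul_two_pi_mul_I, mul_one, mul_assoc]
  rw [hcpow]
  refine Real.norm_exp_I_mul_ofReal_sub_one_le.trans (le_of_eq ?_)
  rw [Real.norm_eq_abs, hx]
  have : -τ * Real.log p - 2 * Real.pi * m =
      2 * Real.pi * (τ * (-Real.log p / (2 * Real.pi)) - m) := by
    field_simp
  rw [this, abs_mul, abs_of_pos Real.two_pi_pos]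

end Literature.NumberTheory.LFunctions
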